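import Summits.QuantumFields.BalabanUV.T4Continuum.Spine.NE1p.DressedTowerWitnessGauge

/-!
# T⁴ programme, spine estimate NE1′ (node O3b/H2) — THE GAUGE QUOTIENT ACTS, part 2 of 3: the plaquette-reading carried functionals on
# row W7's tower, `hFn` as an equation, **`hinv` BY STOKES**, **`hpairx` THROUGH THE GAUGE QUOTIENT**, and the booking convention over
# gauge orbits (formalisation crew `b2b-balaban-t4-ne1p-formalise-*`, leaf seat 03, generation 4, witness row W15; INTENT CLAIMS.log
# l.12021)

Cell `pub-balaban`, sub-cell `t4`, BINDER-OWNERS row NE1′.  ADDITIVE — imports part 1 `Spine/NE1p/DressedTowerWitnessGauge` (the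
raw-rate schedule `Wr`, `grad`∕`plq`∕`rd`∕`plqPat`, the atoms `atomG`; through it W11r part 1 p216180, S3l p215128, W7 p214450 ∕
p214558, W5 p213903 ∕ p214143) ONLY; modifies nothing.  Part 3 = `Spine/NE1p/DressedTowerWitnessGaugeEnd.lean`.

CONTENT (all on W7's tower `towerM` — `BM K`, `TM K`, `aM K`, `wtM`, `shiftM` by name; W11r's cutoff-guarded live generations `SgM`):
* §4 THE CARRIED FUNCTIONALS `FnG K 0 k U = a_K·(rd U + shift k)` (later generations `0`) and the dictionary exponent
  `𝒬G K k U z = ¼·a_K·rd z`: **`hinvG : GaugeInvariant (fun U V => ∃ g, V = U + grad g) (FnG K k' k)` BY STOKES** (a genuine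
  invariance proof — in every earlier witness `hinv` was `h ▸ rfl` for `rel := Eq`); the weights at the two atoms (`1`, W7's
  `e^{−x_k}` — the pure gauge is invisible), the dressed operation in closed form, **`hFn` AS AN EQUATION** (`FnG_succ`: W7's
  recursion verbatim, since `rd (atomG k) = δf_k`), the dictionary `hQG`, and the cutoff-guarded `𝒬TG`∕`hQTG`∕`hFnTG` (W11r's pattern).
* §5 THE BINDERS THAT SEE THE GAUGE RELATION: **`relGauge_pairsG`** — the fresh pair `(Y, Y + atomG k)` is in relative gauge with
  defect `δf_k` by GAUGING AWAY `grad (gpot k)` (direction = the transverse part `dirTrv k`, `g := −gpot k`), although its raw sup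
  distance is `gsz k > δf_k` (`not_relGauge_eq_atomG`: with `rel := Eq` NO defect below `gsz k` serves); births `hslG` on the raw-rate windows (all inside `bondBall c_M`, so
  W7's generation sizes dominate); supports `hDμG`∕`hz₁R`; the booking convention `hneG`∕`hsupG` — increments over the GAUGE ORBITS of
  chart images are bounded by `a_K·latN p` BECAUSE `FnG` is invariant (`osc_leG`), and attained along `defW (k+1)·plqPat`
  (`osc_dirPatG`), so `lin ≤ sSup` by `le_csSup`.

DECLARED ≡ 0: `𝒜 ≡ 0`, `s ≡ 0`, `creg ≡ 0`, `Sabs ≡ ∅`, `ref = id` (live in W9∕W12∕W10∕W13).  LIVE HERE AND IN NO EARLIER WITNESS: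
`rel ≠ Eq`, `hinv` by Stokes, `hpairx`∕`hne`∕`hsup` through gauge orbits.  Not an estimate; nothing of Bałaban's densities; no
`def … : Prop`; [folklore] toy kernel mathematics, 0 sorry, 0 citations.  HONEST FRAMING.  Rung (B)+1 on ONE finite four-torus — NOT
infinite volume, NOT a mass gap, NOT OS on ℝ⁴, NOT Clay.  NE1′ NOT PRINTED, NOT PROVED («NE1′ ⇐ the named binders»); spine PROVED
0∕9.  HONEST DEPENDENCY: continuum YM on T⁴ ⇐ BetaPertH ∧ nine spine estimates (0/9 proved); BetaPertH ⇐ (D1) ∧ (D4) ∧ CAP+tail;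
G-an2-4 gates asym, D1 and NE2/3/4.
-/

noncomputable section

namespace Summit.QuantumFields.BalabanUV.T4Continuum.NE1p.DressedTowerWitnessGauge


open MeasureTheory Set Metric Filter Finset
open scoped BigOperators
open Literature.MathematicalPhysics.QuantumFieldTheory.Balaban1983to89
open Literature.MathematicalPhysics.QuantumFieldTheory.Balaban1983to89.T4TermFormat
open Literature.MathematicalPhysics.QuantumFieldTheory.Balaban1983to89.T4TermFormat.Booking
open Literature.MathematicalPhysics.QuantumFieldTheory.Balaban1983to89.T4GatedBooking
open Literature.MathematicalPhysics.QuantumFieldTheory.Balaban1983to89.T4TrajectoryComparison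
open B8Lemma1Lattice (e)
open T4TrajectoryModulus (bondBall bondBall_add_mem bondBall_latMove_add_mem bondBall_diam)
open T4BlockTransport (Fld NDir latMove latN Site norm_dir_le)
open T4BirthChartTransport (GaugeInvariant BirthSlice RelGauge)
open T4TrajectoryDensity
open Summit.QuantumFields.BalabanUV.T4Continuum.T4TrajectoryDensityDressed
open Summit.QuantumFields.BalabanUV.T4Continuum.T4TrajectoryDensityWitness
open Summit.QuantumFields.BalabanUV.T4Continuum.NE1p.DressedRoot
open Summit.QuantumFields.BalabanUV.T4Continuum.NE1p.DressedUniformConstants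
open Summit.QuantumFields.BalabanUV.T4Continuum.NE1p.DressedWindowScheduleWin
open Summit.QuantumFields.BalabanUV.T4Continuum.NE1p.DressedWindowScheduleModWin
open Summit.QuantumFields.BalabanUV.T4Continuum.NE1p.DressedTowerWitness
open Summit.QuantumFields.BalabanUV.T4Continuum.NE1p.DressedTowerWitnessSlice
open Summit.QuantumFields.BalabanUV.T4Continuum.NE1p.DressedTerminalWitnessReuse

/-! ## §4 The carried functionals, the dictionary exponent, weights, `hFn` as an equation, `hinv` by Stokes [decided toy] -/

/-- THE CARRIED FUNCTIONALS at cutoff `K` [decided toy]: generation `0` at scale `k` is `a_K·(rd U + shift k)` — W7's affine functional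
with the bond reading `U₀₀` replaced by the gauge-invariant plaquette reading; later generations `0`. [folklore] -/
def FnG (K : ℕ) (k' k : ℕ) (U : Fld 4 ℂ) : ℂ := if k' = 0 then (aM K : ℂ) * (rd U + (shiftM K k : ℂ)) else 0

/-- THE OBSERVABLE-ATTACHED EXPONENT BY THE DICTIONARY [decided toy]: `¼·a_K·rd z` (`= c₀·(FnG K 0 k (U+z) − FnG K 0 k (U+0))`,
`c₀ = ¼`). [folklore] -/
def 𝒬G (K : ℕ) (_k : ℕ) (_U z : Fld 4 ℂ) : ℂ := ((1 / 4 : ℝ) : ℂ) * (aM K : ℂ) * rd z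

/-- **`hinv` — GAUGE INVARIANCE OF THE CARRIED FUNCTIONALS, BY STOKES** [folklore]: `FnG K k' k (U + grad g) = FnG K k' k U`. -/
theorem hinvG (K k' k : ℕ) :
    GaugeInvariant (fun U V : Fld 4 ℂ => ∃ g : Site 4 → ℂ, V = U + grad g) (FnG K k' k) := by
  rintro U V ⟨g, rfl⟩
  simp [FnG]

/-- The weight at the reference atom `0` is `1`. [folklore] -/
theorem expWeight_G_zero (K k : ℕ) (U : Fld 4 ℂ) : expWeight base₁ (zeroExp + 𝒬G K k) U 0 = 1 := by
  simp [expWeight_apply, base₁, zeroExp, 𝒬G]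

/-- The weight at the second atom is W7's `e^{−x_k}` (the pure gauge is invisible). [folklore] -/
theorem expWeight_G_atom (K k : ℕ) (U : Fld 4 ℂ) :
    expWeight base₁ (zeroExp + 𝒬G K k) U (atomG k) = (wtM K k : ℂ) := by
  simp only [expWeight_apply, base₁, zeroExp, 𝒬G, Pi.add_apply, rd_atomG, zero_add, Complex.ofReal_one, one_mul, wtM, xM,
    Complex.ofReal_exp]
  congr 1
  push_cast
  ring

/-- **THE DRESSED OPERATION IN CLOSED FORM** [folklore]: `wOp … U h = (h 0 + e^{−x_k}·h (atomG k))∕(1 + e^{−x_k})`. -/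
theorem wOp_weightedG (K k : ℕ) (U : Fld 4 ℂ) (h : Fld 4 ℂ → ℂ) :
    wOp (expWeight base₁ (zeroExp + 𝒬G K k)) (flAt (atomG k)) 0 U h =
      ((1 + wtM K k : ℝ) : ℂ)⁻¹ * (h 0 + (wtM K k : ℂ) * h (atomG k)) := by
  have hpos : (0 : ℝ) < 1 + wtM K k := by have := wtM_pos K k; linarith
  have hne : ((1 + wtM K k : ℝ) : ℂ) ≠ 0 := by exact_mod_cast hpos.ne'
  have hint : ∫ z, expWeight base₁ (zeroExp + 𝒬G K k) U z ∂flAt (atomG k) = ((1 + wtM K k : ℝ) : ℂ) := by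
    rw [integral_flAt, expWeight_G_zero, expWeight_G_atom]; push_cast; ring
  rw [wOp_of_pos (integrable_flAt _ _) (by rw [hint]; exact hne), hint, integral_flAt, expWeight_G_zero, expWeight_G_atom]
  simp only [smul_eq_mul, one_mul]

/-- **`hFn` AS AN EQUATION** [folklore]: the step `k → k+1` of the carried functional IS the dressed operation (live exponent,
two-atom measure with the gauge-dressed atom) on the translates — W7's recursion verbatim, since `rd (atomG k) = δf_k`. -/
theorem FnG_succ (K k' k : ℕ) (U : Fld 4 ℂ) :
    FnG K k' (k + 1) U =
      wOp (expWeight base₁ (zeroExp + 𝒬G K k)) (flAt (atomG k)) 0 U (fun z => FnG K k' k (U + z)) := by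
  have hpos : (0 : ℝ) < 1 + wtM K k := by have := wtM_pos K k; linarith
  have hne : (1 : ℂ) + (wtM K k : ℂ) ≠ 0 := by exact_mod_cast hpos.ne'
  rw [wOp_weightedG]
  by_cases h : k' = 0
  · subst h
    simp only [FnG, ↓reduceIte, shiftM, rd_add, rd_atomG, add_zero]
    push_cast
    field_simp
    ring
  · simp [FnG, h]

/-- THE DICTIONARY `hQ` AS AN EQUATION [folklore]: the centred observable-attached exponent IS `c₀ = ¼` times the fresh difference of
the live generation `(b, 0)` at the pair `(U+z, U+0)`. -/
theorem hQG (K : ℕ) (b : (BM K).Birth) (k : ℕ) :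
    (fun U z => 𝒬G K k U z - (fun (_ : Fld 4 ℂ) => (0 : ℂ)) U) =
      fun U z => ((1 / 4 : ℝ) : ℂ) * ∑ p ∈ ({(b, 0)} : Finset ((BM K).Birth × ℕ)),
        (FnG K p.2 k (U + z) - FnG K p.2 k (U + (fun (_ : (BM K).Birth) (_ : ℕ) => (0 : Fld 4 ℂ)) b k)) := by
  funext U z
  simp only [Finset.sum_singleton, FnG, ↓reduceIte, rd_add, add_zero, 𝒬G, sub_zero]
  ring

/-- The dictionary exponent guarded by the cutoff [decided toy]: LIVE `𝒬G K k` at and below the cutoff, `0` above it (W11r's `𝒬T`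
pattern: `hQ` an EQUATION at every `k`, `hFn` — asked only below the cutoff — the recursion `FnG_succ`). [folklore] -/
def 𝒬TG (K k : ℕ) : Fld 4 ℂ → Fld 4 ℂ → ℂ := if k ≤ K then 𝒬G K k else zeroExp

/-- [folklore] -/ theorem 𝒬TG_of_le {K k : ℕ} (hk : k ≤ K) : 𝒬TG K k = 𝒬G K k := if_pos hk
/-- [folklore] -/ theorem 𝒬TG_of_not_le {K k : ℕ} (hk : ¬ k ≤ K) : 𝒬TG K k = zeroExp := if_neg hk

/-- THE DICTIONARY `hQ` AT EVERY STEP over W11r's live generations `SgM` [folklore]. -/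
theorem hQTG (K : ℕ) (b : (BM K).Birth) (k : ℕ) :
    (fun U z => 𝒬TG K k U z - (fun (_ : Fld 4 ℂ) => (0 : ℂ)) U) =
      fun U z => ((1 / 4 : ℝ) : ℂ) * ∑ p ∈ SgM K k b,
        (FnG K p.2 k (U + z) - FnG K p.2 k (U + (fun (_ : (BM K).Birth) (_ : ℕ) => (0 : Fld 4 ℂ)) b k)) := by
  by_cases hk : k ≤ K
  · rw [𝒬TG_of_le hk, SgM_of_le hk]
    exact hQG K b k
  · rw [𝒬TG_of_not_le hk, SgM_of_not_le hk]
    funext U z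
    simp [zeroExp]

/-- THE STEP LAW `hFn` below the cutoff [folklore]: `FnG_succ` (the guard `k + 1 ≤ K` puts `𝒬TG K k = 𝒬G K k`). -/
theorem hFnTG (K k' k : ℕ) (hk : k + 1 ≤ K) (U : Fld 4 ℂ) :
    FnG K k' (k + 1) U =
      wOp (expWeight base₁ (zeroExp + 𝒬TG K k)) (flAt (atomG k)) 0 U (fun z => FnG K k' k (U + z)) := by
  rw [𝒬TG_of_le (Nat.le_of_succ_le hk)]
  exact FnG_succ K k' k U

/-! ## §5 The binders that see the gauge relation, and the remaining function-level binders [folklore] -/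

/-- The direction realising the fresh pair at the second atom: ITS TRANSVERSE PART, declared bound `δf_k`. [folklore] -/
def dirTrv (k : ℕ) : NDir 4 ℂ := fldDir (trv k) (dfW k) (norm_trv_le k)

/-- The direction realising the trivial pair at the reference atom: the zero field, declared bound `δf_k > 0`. [folklore] -/
def dirNullG (k : ℕ) : NDir 4 ℂ := fldDir 0 (dfW k) fun x ν => by simpa using (dfW_pos k).le

/-- **`hpairx` AT BOTH ATOMS, THROUGH THE GAUGE QUOTIENT** [folklore]: for μ-a.e. fluctuation `z` (`z = 0` or `z = atomG k`) and EVERY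
base `Y`, the pair `(Y + 0, Y + z)` is in relative gauge with defect `δf_k`: at the dressed atom the chart moves along the TRANSVERSE
part only and the pure gauge `grad (gpot k)` is GAUGED AWAY (`g := −gpot k`).  With `rel := Eq` this pair would need the defect
`gsz k > δf_k` (`not_relGauge_eq_atomG`). -/
theorem relGauge_pairsG (k : ℕ) :
    ∀ᵐ z ∂flAt (atomG k), ∀ Y : Fld 4 ℂ,
      RelGauge (fun U V : Fld 4 ℂ => ∃ g : Site 4 → ℂ, V = U + grad g) latMove latN (Y + 0) (Y + z) (dfW k) := by
  refine ae_flAt.mpr ⟨fun Y => ⟨dirNullG k, dfW_pos k, le_rfl, fun _ => 0, ?_⟩,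
    fun Y => ⟨dirTrv k, dfW_pos k, le_rfl, -gpot k, ?_⟩⟩
  · show latMove (Y + 0) (dirNullG k) 1 = Y + 0 + grad (fun _ : Site 4 => (0 : ℂ))
    rw [dirNullG, latMove_fldDir_one, add_zero, add_zero, grad_zeroFn, add_zero]
  · show latMove (Y + 0) (dirTrv k) 1 = Y + atomG k + grad (-gpot k)
    rw [dirTrv, latMove_fldDir_one, add_zero, grad_negFn, atomG]
    abel

/-- **THE RAW READING FAILS AT THE TRANSVERSE DEFECT** [folklore]: with `rel := Eq` the pair `(Y, Y + atomG k)` is NOT in relative gauge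
with any defect below the pure-gauge size `gsz k` — the chart would have to move by the atom itself, whose bond `⟨0,e₃⟩` carries
`gsz k`. -/
theorem not_relGauge_eq_atomG (k : ℕ) (Y : Fld 4 ℂ) {δ : ℝ} (hδ : δ < gsz k) :
    ¬ RelGauge (fun U V : Fld 4 ℂ => U = V) latMove latN (Y + 0) (Y + atomG k) δ := by
  rintro ⟨p, _, hpδ, hrel⟩
  have h03 : atomG k 0 3 = p.1.1 0 3 := by
    have := congr_fun (congr_fun hrel 0) 3
    simp only [Pi.add_apply, latMove, Pi.zero_apply, add_zero, one_smul] at this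
    linear_combination this
  have h1 : gsz k ≤ latN p := by
    rw [← norm_atomG_gaugeBond k, h03]
    exact norm_dir_le p 0 3
  linarith

/-- `hsl` (w1): birth slices on every raw-rate window (all inside `bondBall c_M`), bound W7's `a_K·(c_M + 3)`; later generations `0`. [folklore] -/
theorem hslG (K : ℕ) (b : (BM K).Birth) (k' : ℕ) :
    BirthSlice (FnG K k' k') latMove latN (bondBall 4 (Wr.ρw k') : Set (Fld 4 ℂ)) 1 1 ((TM K).gen b k') := by
  intro U hU p hp hp1
  by_cases hk : k' = 0
  · subst hk
    have hUc : ‖rd U‖ ≤ cM := (norm_rd_le hU).trans (Wr_ρw_le_cM 0)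
    refine ⟨ball 0 (3 / latN p), ?_, fun t ht => ?_, discs_subset_ball hp hp1 (by norm_num)⟩
    · simp only [FnG, ↓reduceIte, rd_latMove]; fun_prop
    · show ‖FnG K 0 0 (latMove U p t)‖ ≤ (if (0 : ℕ) = 0 then aM K * (cM + 3) else 0)
      simp only [FnG, ↓reduceIte, rd_latMove, shiftM, Complex.ofReal_zero, add_zero]
      have h3 := norm_t_rd_le p hp ht
      rw [norm_mul, Complex.norm_real, Real.norm_eq_abs, abs_of_pos (aM_pos K)]
      calc aM K * ‖rd U + t * rd p.1.1‖ ≤ aM K * (‖rd U‖ + ‖t * rd p.1.1‖) :=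
            mul_le_mul_of_nonneg_left (norm_add_le _ _) (aM_pos K).le
        _ ≤ aM K * (cM + 3) := mul_le_mul_of_nonneg_left (by linarith) (aM_pos K).le
  · refine ⟨univ, ?_, fun t _ => ?_, fun _ _ => subset_univ _⟩
    · simp only [FnG, if_neg hk]; fun_prop
    · show ‖FnG K k' k' (latMove U p t)‖ ≤ (if k' = 0 then aM K * (cM + 3) else 0)
      simp [FnG, hk]

/-- `hDμ`: both atoms of the step-`k` measure lie in `bondBall (σ k)`. [folklore] -/
theorem hDμG (k : ℕ) : ∀ᵐ z ∂flAt (atomG k), z ∈ (bondBall 4 (Wr.σ k) : Set (Fld 4 ℂ)) :=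
  ae_flAt.mpr ⟨fun x ν => by rw [Pi.zero_apply, Pi.zero_apply, norm_zero]; exact (Wr.hσ k).le, atomG_mem k⟩

/-- `hz₁`: the reference fluctuation `0` lies in every fluctuation ball. [folklore] -/
theorem hz₁R (k : ℕ) : (0 : Fld 4 ℂ) ∈ (bondBall 4 (Wr.σ k) : Set (Fld 4 ℂ)) := fun x ν => by
  rw [Pi.zero_apply, Pi.zero_apply, norm_zero]; exact (Wr.hσ k).le

/-- The direction attaining the booked size: W5's transverse defect on the plaquette pattern, declared bound `δ_{k+1}`. [folklore] -/
def dirPat (k : ℕ) : NDir 4 ℂ := fldDir (((defW (k + 1) : ℝ) : ℂ) • plqPat) (defW (k + 1)) fun x ν => by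
  simp only [Pi.smul_apply, smul_eq_mul, norm_mul, Complex.norm_real, Real.norm_eq_abs, abs_of_pos (defW_pos (k + 1))]
  exact mul_le_of_le_one_right (defW_pos (k + 1)).le (norm_plqPat_le x ν)

/-- **THE INCREMENT BOUND OVER GAUGE ORBITS** [folklore]: an admissible pair `(U₀, U₁)` of defect `δ_{k+1}` has `U₀`'s chart image
`latMove U₀ p 1 = U₁ + grad g` with `latN p ≤ δ_{k+1}`; since `FnG` is gauge INVARIANT the increment is `a_K·‖rd p‖ ≤ a_K·δ_{k+1} =
lin b 0 k` — bounded, for every gauge copy `U₁` of the chart image (later generations: `0 ≤ 0`). -/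
theorem osc_leG (K : ℕ) (b : (BM K).Birth) (k' k : ℕ) {U₀ U₁ : Fld 4 ℂ}
    (h : RelGauge (fun U V : Fld 4 ℂ => ∃ g : Site 4 → ℂ, V = U + grad g) latMove latN U₀ U₁ (defW (k + 1))) :
    ‖FnG K k' k U₁ - FnG K k' k U₀‖ ≤ (TM K).lin b k' k := by
  obtain ⟨p, _, hpδ, g, hg⟩ := h
  have hinv : FnG K k' k U₁ = FnG K k' k (latMove U₀ p 1) := hinvG K k' k _ _ ⟨g, hg⟩
  rw [hinv]
  show _ ≤ (if k' = 0 then aM K * defW (k + 1) else 0)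
  by_cases hk : k' = 0
  · subst hk
    simp only [FnG, ↓reduceIte, rd_latMove, one_mul]
    rw [show (aM K : ℂ) * (rd U₀ + rd p.1.1 + (shiftM K k : ℂ)) - (aM K : ℂ) * (rd U₀ + (shiftM K k : ℂ)) =
        (aM K : ℂ) * rd p.1.1 by ring,
      norm_mul, Complex.norm_real, Real.norm_eq_abs, abs_of_pos (aM_pos K)]
    exact mul_le_mul_of_nonneg_left ((norm_rd_dir_le p).trans hpδ) (aM_pos K).le
  · simp [FnG, hk]

/-- **THE INCREMENT IS ATTAINED** [folklore]: along `dirPat (k+1) = δ_{k+1}·plqPat` from the base `0` the increment IS the booked size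
`a_K·δ_{k+1}` (the dressing cancels, the pattern reads `1`). -/
theorem osc_dirPatG (K : ℕ) (b : (BM K).Birth) (k' k : ℕ) :
    ‖FnG K k' k (latMove 0 (dirPat k) 1) - FnG K k' k 0‖ = (TM K).lin b k' k := by
  have hmove : rd (latMove 0 (dirPat k) 1) = ((defW (k + 1) : ℝ) : ℂ) := by
    rw [dirPat, latMove_fldDir_one, zero_add, rd_smul, rd_plqPat, mul_one]
  show _ = (if k' = 0 then aM K * defW (k + 1) else 0)
  by_cases hk : k' = 0
  · subst hk
    simp only [↓reduceIte, FnG, hmove, rd_zero, zero_add]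
    rw [show (aM K : ℂ) * (((defW (k + 1) : ℝ) : ℂ) + (shiftM K k : ℂ)) - (aM K : ℂ) * (shiftM K k : ℂ) =
        ((aM K * defW (k + 1) : ℝ) : ℂ) by push_cast; ring,
      Complex.norm_real, Real.norm_eq_abs, abs_of_pos (mul_pos (aM_pos K) (defW_pos (k + 1)))]
  · simp [FnG, hk]

/-- `hne` — ADMISSIBLE PAIRS EXIST [folklore]: base `0` (in every raw-rate window), the chart image along `dirPat k` (a gauge copy of
itself with `g = 0`). -/
theorem hneG (k : ℕ) : ∃ U₀ ∈ (bondBall 4 (Wr.ρw k) : Set (Fld 4 ℂ)), ∃ U₁ : Fld 4 ℂ,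
    RelGauge (fun U V : Fld 4 ℂ => ∃ g : Site 4 → ℂ, V = U + grad g) latMove latN U₀ U₁ (defW (k + 1)) :=
  ⟨0, zero_mem_windowR k, latMove 0 (dirPat k) 1, ⟨dirPat k, defW_pos (k + 1), le_rfl, fun _ => 0, by rw [grad_zeroFn, add_zero]⟩⟩

/-- **`hsup` — THE BOOKED SIZE IS BELOW THE SUP OF THE INCREMENTS REALISED OVER GAUGE ORBITS** (row S8's booking convention with
`Real.sSup`) [folklore]: bounded above by the booked size (`osc_leG`, by INVARIANCE) and attained (`osc_dirPatG`), so `lin ≤ sSup`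
by `le_csSup`. -/
theorem hsupG (K : ℕ) (b : (BM K).Birth) (k' k : ℕ) :
    (TM K).lin b k' k ≤ sSup {x : ℝ | ∃ U₀ ∈ (bondBall 4 (Wr.ρw k) : Set (Fld 4 ℂ)), ∃ U₁ : Fld 4 ℂ,
      RelGauge (fun U V : Fld 4 ℂ => ∃ g : Site 4 → ℂ, V = U + grad g) latMove latN U₀ U₁ (defW (k + 1)) ∧
        x = ‖FnG K k' k U₁ - FnG K k' k U₀‖} := by
  refine le_csSup ⟨(TM K).lin b k' k, fun x hx => ?_⟩
    ⟨0, zero_mem_windowR k, latMove 0 (dirPat k) 1, ⟨dirPat k, defW_pos (k + 1), le_rfl, fun _ => 0, by rw [grad_zeroFn, add_zero]⟩,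
      (osc_dirPatG K b k' k).symm⟩
  obtain ⟨U₀, _, U₁, hrel, rfl⟩ := hx
  exact osc_leG K b k' k hrel

end Summit.QuantumFields.BalabanUV.T4Continuum.NE1p.DressedTowerWitnessGauge

end
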